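import Literature.Barriers.ValiantsHypothesis.BIJL18PermanentZero
import Literature.LinearAlgebra.Matrix.PermanentLaplace
import HarnessLib

/-!
# Bläser–Ikenmeyer–Jindal–Lysikov 2018, §6 — discharge of the properties of the matrix `Z(X)`

Sibling proof file of `BIJL18PermanentZero.lean` (val-lit t23). Proves the named fact
`BIJL2018_sec6_zMatrix K` [BlaserIkenmeyerJindalLysikov2018, §6, ECCC p.18]: "We have
`Per Z = 0`. Moreover, any matrix with `Per Z = 0` and `Per Z_{nn} ≠ 0` can be obtained in this
way, by Laplace expansion." Both halves are the Laplace expansion of the permanent along the last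
row (`Matrix.permanent_eq_sum_row`, `Literature/LinearAlgebra/Matrix/PermanentLaplace.lean`): the
minors of `Z(X)` with the last row deleted are those of `X`, so
`Per Z(X) = Σ_{j<n} x_{nj}·Per(X_{nn})·Per(X_{nj}) − (Σ_{j<n} x_{nj}·Per(X_{nj}))·Per(X_{nn}) = 0`;
conversely `X := Z` with the last row divided by `Per(Z_{nn})` has `Z(X) = Z`. Theorem-only file.
HONEST FRAMING: typed literature; `VP ≠ VNP` is NOT proved.
-/

noncomputable section

namespace Literature.Barriers.ValiantsHypothesis

universe u

variable {K : Type u} [Field K] {n : ℕ}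

/-- Rows other than the last of `Z(X)` are those of `X`.
[cite: BlaserIkenmeyerJindalLysikov2018, §6 (construction of `Z`)] locator: ECCC p.18 -/
theorem zMatrix_apply_of_ne_last (X : Matrix (Fin (n + 1)) (Fin (n + 1)) K) {i : Fin (n + 1)}
    (hi : i ≠ Fin.last n) (j : Fin (n + 1)) : zMatrix X i j = X i j := by
  simp [zMatrix, hi]

/-- The last row of `Z(X)` off the corner: `x_{nj} · Per(X_{nn})`.
[cite: BlaserIkenmeyerJindalLysikov2018, §6 (construction of `Z`)] locator: ECCC p.18 -/
theorem zMatrix_last_apply_of_ne_last (X : Matrix (Fin (n + 1)) (Fin (n + 1)) K) {j : Fin (n + 1)}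
    (hj : j ≠ Fin.last n) :
    zMatrix X (Fin.last n) j =
      X (Fin.last n) j * (X.submatrix (Fin.last n).succAbove (Fin.last n).succAbove).permanent := by
  simp [zMatrix, hj]

/-- The corner entry of `Z(X)`: `−Σ_{j<n} x_{nj} · Per(X_{nj})`.
[cite: BlaserIkenmeyerJindalLysikov2018, §6 (construction of `Z`)] locator: ECCC p.18 -/
theorem zMatrix_last_last (X : Matrix (Fin (n + 1)) (Fin (n + 1)) K) :
    zMatrix X (Fin.last n) (Fin.last n) = -∑ j' : Fin n, X (Fin.last n) (Fin.castSucc j') *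
      (X.submatrix (Fin.last n).succAbove (Fin.castSucc j').succAbove).permanent := by
  simp [zMatrix]

/-- Deleting the last row, the minors of `Z(X)` are those of `X`.
[cite: BlaserIkenmeyerJindalLysikov2018, §6 (construction of `Z`)] locator: ECCC p.18 -/
theorem zMatrix_submatrix_last (X : Matrix (Fin (n + 1)) (Fin (n + 1)) K) (c : Fin n → Fin (n + 1)) :
    (zMatrix X).submatrix (Fin.last n).succAbove c = X.submatrix (Fin.last n).succAbove c := by
  ext i j
  simp only [Matrix.submatrix_apply]
  exact zMatrix_apply_of_ne_last X (Fin.succAbove_ne _ _) _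

/-- **§6: `Per Z(X) = 0`** (Laplace expansion along the last row).
[cite: BlaserIkenmeyerJindalLysikov2018, §6 (construction of `Z`)] locator: ECCC p.18 -/
theorem permanent_zMatrix (X : Matrix (Fin (n + 1)) (Fin (n + 1)) K) : (zMatrix X).permanent = 0 := by
  rw [Matrix.permanent_eq_sum_row _ (Fin.last n), Fin.sum_univ_castSucc]
  simp only [zMatrix_submatrix_last]
  rw [zMatrix_last_last]
  have h : ∀ j' : Fin n, zMatrix X (Fin.last n) (Fin.castSucc j') *
      (X.submatrix (Fin.last n).succAbove (Fin.castSucc j').succAbove).permanent =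
      X (Fin.last n) (Fin.castSucc j') *
        (X.submatrix (Fin.last n).succAbove (Fin.castSucc j').succAbove).permanent *
        (X.submatrix (Fin.last n).succAbove (Fin.last n).succAbove).permanent := by
    intro j'
    rw [zMatrix_last_apply_of_ne_last X (Fin.castSucc_lt_last j').ne]
    ring
  simp only [h, ← Finset.sum_mul]
  ring

/-- **§6: every `Z` with `Per Z = 0` and `Per Z_{nn} ≠ 0` is of the form `Z(X)`** (take `X := Z`
with the last row divided by `Per Z_{nn}`; the corner entry is recovered by the Laplace expansion
of `Per Z = 0` along the last row). [cite: BlaserIkenmeyerJindalLysikov2018, §6 (construction of `Z`)]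
locator: ECCC p.18 -/
theorem exists_zMatrix_eq (Z : Matrix (Fin (n + 1)) (Fin (n + 1)) K) (hZ : Z.permanent = 0)
    (hp : (Z.submatrix (Fin.last n).succAbove (Fin.last n).succAbove).permanent ≠ 0) :
    ∃ X : Matrix (Fin (n + 1)) (Fin (n + 1)) K, zMatrix X = Z := by
  set p := (Z.submatrix (Fin.last n).succAbove (Fin.last n).succAbove).permanent with hpdef
  set X : Matrix (Fin (n + 1)) (Fin (n + 1)) K :=
    fun i j => if i = Fin.last n then Z i j / p else Z i j with hXdef
  have hXrow : ∀ {i : Fin (n + 1)}, i ≠ Fin.last n → ∀ j, X i j = Z i j := by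
    intro i hi j
    simp [hXdef, hi]
  have hXlast : ∀ j, X (Fin.last n) j = Z (Fin.last n) j / p := by
    intro j
    simp [hXdef]
  have hXsub : ∀ c : Fin n → Fin (n + 1),
      X.submatrix (Fin.last n).succAbove c = Z.submatrix (Fin.last n).succAbove c := by
    intro c
    ext i j
    exact hXrow (Fin.succAbove_ne _ _) _
  refine ⟨X, ?_⟩
  ext i j
  by_cases hi : i = Fin.last n
  · subst hi
    by_cases hj : j = Fin.last n
    · subst hj
      rw [zMatrix_last_last]
      simp only [hXsub, hXlast]
      have hL := Matrix.permanent_eq_sum_row Z (Fin.last n)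
      rw [Fin.sum_univ_castSucc, hZ] at hL
      have hs : ∑ j' : Fin n, Z (Fin.last n) (Fin.castSucc j') / p *
          (Z.submatrix (Fin.last n).succAbove (Fin.castSucc j').succAbove).permanent =
          (∑ j' : Fin n, Z (Fin.last n) (Fin.castSucc j') *
            (Z.submatrix (Fin.last n).succAbove (Fin.castSucc j').succAbove).permanent) / p := by
        rw [Finset.sum_div]
        exact Finset.sum_congr rfl fun _ _ => by ring
      rw [← hpdef] at hL
      rw [hs]
      field_simp
      linear_combination hL
    · rw [zMatrix_last_apply_of_ne_last X hj, hXsub, hXlast, ← hpdef]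
      exact div_mul_cancel₀ _ hp
  · rw [zMatrix_apply_of_ne_last X hi, hXrow hi]

variable (K) in
/-- **BIJL §6, properties of `Z(X)`, hold** (discharge of `BIJL2018_sec6_zMatrix`).
[cite: BlaserIkenmeyerJindalLysikov2018, §6 (construction of `Z`)] locator: ECCC p.18 -/
theorem BIJL2018_sec6_zMatrix_holds : BIJL2018_sec6_zMatrix K :=
  fun _ => ⟨fun X => permanent_zMatrix X, fun Z hZ hp => exists_zMatrix_eq Z hZ hp⟩

end Literature.Barriers.ValiantsHypothesis

end
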